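import Summits.ABC.IUTFork.ForkGenuineRatInputs
import HarnessLib

/-!
# The fork at [IUTchIII] Corollary 3.12 at a GENUINE input: the E-MIN LAW at an unramified odd prime — for ANY input and
# ANY ideles the only inflation is the (Ind1) mixing gain `E[n] − E[min]` (skeleton XXVIIf)

Record-only file (D-0012) of the abc-iut cell (deliverable (a), skeleton seat abc-iut-skel, gen 9); TAKES NO SIDE.
Sequel to `ForkGenuineDepthZeroInflation.lean` (XXVIId-b, p436438: SLOT-CONSTANT scalar ideles `p^{n_i}` at an unramified odd prime
have `−|log(Θ)|_p = (1/ℓ⋇)Σ_i (−n_i·log p)`), `ForkGenuineDepthBadMassExact.lean` (XXVIId-c, p437902: ONE bad place of mass `β`) and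
`ForkGenuineRatInputs.lean` (XXVIIe-c, p446091: the norm form on rank-one packets). HERE the general law, for ARBITRARY ideles
`t_{i,v} ∈ K_{v̲}^×` given by their norms `‖t_{i,v}‖ = p^{−n_i(v)}` (at an absolutely unramified `K_{v̲}` every element has such an
integral exponent, `exists_int_norm_eq_of_unramified`):

* `iota_smul_normalizedPacket_eq_zpow_smul_of_norm_eq` (packet algebra, ANY rank, ANY prime): a slot element with `‖t‖ = p^{−n}` moves
  the integral structure to `p^n·(R_I)^∼` (`t = p^n·u`, `‖u‖ = 1`, a unit does not move `(R_I)^∼`);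
* `iUnion_zpow_smul_normalizedPacket_eq` — the slot regions are NESTED scalar balls (`p^{n−m} ∈ (R_I)^∼`), so the (Ind1)-SLOT UNION over a tuple `v⃗` is the
  largest one: `⋃_b p^{n(v_b)}·(R_{v⃗})^∼ = p^{min_b n(v_b)}·(R_{v⃗})^∼`;
* **`realPrimePacketWith_negLogThetaAt_eq_min_of_unramified`** — at `p > 2` with every `K_v` (`v | p`) absolutely unramified, ANY shell
  scalar, ANY idele: `−|log(Θ)|_p = −(log p/ℓ⋇)·Σ_i Σ_{v⃗ ∈ 𝕍_p^{i+2}} (Π_b Pr(v_b))·min_b n_i(v_b)` EXACTLY — the (Ind2)-orbit and the hull of a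
  scalar ball are the ball itself ([IUTchIV] Prop. 1.2 (iv), XXVIId-b's `iUnion_indTwo_smul_smul_normalizedPacket_eq`), so the ONLY effect
  of the indeterminacies is (Ind1)'s replacement of the last-slot exponent by the MINIMUM over the slots (probabilistically: `E[n(v)]` becomes
  `E[min of i+2 i.i.d. copies]` under `Pr`; the rank-one twin at ANY prime is XXVIIe-c's norm form);
* **`realPrimePacketWith_negAbsLogQAt_eq_of_norm`** — the BARE value `ln ν̄(O_𝕃(−div t)_p) = −(log p/ℓ⋇)·Σ_i Σ_{v⃗} (Π Pr)·n_i(v_{last})`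
  (any prime, any rank), so **`mixing_gain_eq`**: inflation at such a prime `= (1/ℓ⋇)·Σ_i Σ_{v⃗} (n_i(v_last) − min_b n_i(v_b))·log p·(Π Pr) ≥ 0`
  (`negAbsLogQAt_le_negLogThetaAt_of_unramified`), and it VANISHES IFF every `n_i` is constant on the places over `p`
  (`negLogThetaAt_eq_negAbsLogQAt_iff_slotConstant`);
* input level, for every `I : ThetaVolumeInput F₀ K` and odd `p` with all `σ`-completions absolutely unramified:
  `exists_int_norms_tΘ_of_unramified` (`‖t_{Θ,i,v}‖ = p^{−n_i(v)}` with `e_v·n_i(v) = P_{Θ,i}(v)`), **`negLogThetaLoc_eq_min_of_unramified`**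
  (the E-min law for `negLogThetaLoc I p`), **`negLogThetaLoc_eq_zero_of_unramified_of_forall_not_mem`** ([IUTchIV] Step (vi) AT INPUT LEVEL:
  no bad place over `p` ⇒ the summand is `0`).

READING (grammar of `HOME/skel/FORK-REAL-MODEL.md` §4/§11, `FORK-INDEX.md` row 2; no side taken): in the sharp real model, at every
unramified odd prime the indeterminacies (Ind2) and the hull inflate NOTHING and (Ind1) inflates by exactly the mixing gain, which is
zero unless two places over `p` carry different Θ-depths; all remaining inflation of the typed `−|log(Θ)|` lives at `2` and at the primes
ramified in `K` (the log-shell / different terms). XXVIId-b, XXVIId-c and the `ℚ/ℚ` files are the slot-constant, one-place and rank-one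
specialisations. HONEST SCOPE: inhabitants of abc-iut-S2's INPUT TYPE with genuine completions; at initial Θ-data of [IUTchI] Def. 3.1
the bad primes ARE ramified in `K = F(E_F[l])`, so there the law speaks only about the unramified odd support primes; sharp (Ind3), full
(Ind1)/(Ind2), Mochizuki's container. Nothing here bears on whether [IUTchIII] Thm. 3.11 licenses Cor. 3.12; typed ≠ proved.
PROOF-ONLY file: no definitions, no `Prop` facts.
[cite: Mochizuki2012, IUTchIV Prop. 1.2 (iv) p. 11, Thm. 1.10 Step (v) p. 27–28, Step (vi) p. 29] [cite: DupuyHilado2025, §1 (1.1),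
Def. 3.6.3, §3.9, Thm. 3.10.1, §4.7, §4.9, §4.11–4.12] [cite: Mochizuki2012, IUTchIII Cor. 3.12 p. 173–174] [claim: Mochizuki2012, status: disputed]
-/

noncomputable section

open Set Module Literature.IUT.LogVolume Literature.NumberTheory.NumberFields NumberField IsDedekindDomain
open scoped Pointwise

namespace Summit.ABC.IUTFork.GenuineContent

/-! ## §1 Packet algebra: slot elements by their norms; nested scalar balls -/

section Packet

variable (p : ℕ) [hp : Fact p.Prime] {ι : Type} [Fintype ι] [DecidableEq ι] [Nonempty ι]
variable (k : ι → Type) [∀ i, NontriviallyNormedField (k i)] [∀ i, NormedAlgebra ℚ_[p] (k i)]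
  [∀ i, IsUltrametricDist (k i)] [∀ i, ProperSpace (k i)]

omit [Fintype ι] [Nonempty ι] [∀ i, IsUltrametricDist (k i)] [∀ i, ProperSpace (k i)] in
/-- **A slot element with `‖t‖ = p^{−n}` moves `(R_I)^∼` to `p^n·(R_I)^∼`** (ANY rank, ANY prime): `t = p^n·u` with `u := p^{−n}·t`,
`‖u‖ = 1`, and a slot unit does not move the integral structure (abc-iut-S2's `iota_smul_normalizedPacket_eq_of_norm_eq_one`).
[cite: Mochizuki2012, IUTchIV Thm. 1.10 Step (v) p. 27, Step (vi) p. 29] [cite: DupuyHilado2025, §3.7, §3.9] -/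
theorem iota_smul_normalizedPacket_eq_zpow_smul_of_norm_eq (a : ι) (t : k a) (n : ℤ) (ht : ‖t‖ = (p : ℝ) ^ (-n)) :
    iota p k a t • (normalizedPacket p k : Set (PacketAlgebra p k)) =
      ((p : ℚ_[p]) ^ n) • (normalizedPacket p k : Set (PacketAlgebra p k)) := by
  have hp0 : (p : ℚ_[p]) ≠ 0 := Nat.cast_ne_zero.mpr hp.out.ne_zero
  have hp0' : (p : ℝ) ≠ 0 := Nat.cast_ne_zero.mpr hp.out.ne_zero
  obtain ⟨u, hu_def⟩ : ∃ u : k a, u = t * algebraMap ℚ_[p] (k a) ((p : ℚ_[p]) ^ (-n)) := ⟨_, rfl⟩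
  have hu : ‖u‖ = 1 := by
    rw [hu_def, norm_mul, norm_algebraMap', norm_zpow, Padic.norm_p, ht, inv_zpow', neg_neg, ← zpow_add₀ hp0',
      neg_add_cancel, zpow_zero]
  have htu : t = algebraMap ℚ_[p] (k a) ((p : ℚ_[p]) ^ n) * u := by
    rw [hu_def, mul_left_comm, ← map_mul, ← zpow_add₀ hp0, add_neg_cancel, zpow_zero, map_one, mul_one]
  rw [htu, map_mul, (iota p k a).commutes, ← smul_smul, iota_smul_normalizedPacket_eq_of_norm_eq_one p k a hu,
    ← smul_set_eq_algebraMap_smul]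

omit [Fintype ι] [∀ i, IsUltrametricDist (k i)] [∀ i, ProperSpace (k i)] in
/-- **A union of nested scalar balls is the largest**: `⋃_b p^{n_b}·(R_I)^∼ = p^{min_b n_b}·(R_I)^∼` (the (Ind1) slot union of a tuple
whose slots carry exponents `n_b`). [cite: DupuyHilado2025, §4.7] -/
theorem iUnion_zpow_smul_normalizedPacket_eq {m : ℕ} (n : Fin (m + 1) → ℤ) :
    (⋃ b, ((p : ℚ_[p]) ^ n b) • (normalizedPacket p k : Set (PacketAlgebra p k))) =
      ((p : ℚ_[p]) ^ Finset.univ.inf' Finset.univ_nonempty n) • (normalizedPacket p k : Set (PacketAlgebra p k)) := by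
  have hp0 : (p : ℚ_[p]) ≠ 0 := Nat.cast_ne_zero.mpr hp.out.ne_zero
  obtain ⟨a⟩ := ‹Nonempty ι›
  -- scalar balls are nested: `p^{n'}·(R_I)^∼ ⊆ p^{m'}·(R_I)^∼` for `m' ≤ n'` (`p^{n'−m'} ∈ (R_I)^∼`)
  have hnest : ∀ {m' n' : ℤ}, m' ≤ n' →
      ((p : ℚ_[p]) ^ n') • (normalizedPacket p k : Set (PacketAlgebra p k)) ⊆
        ((p : ℚ_[p]) ^ m') • (normalizedPacket p k : Set (PacketAlgebra p k)) := by
    intro m' n' h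
    have hsub : ((p : ℚ_[p]) ^ (n' - m')) • (normalizedPacket p k : Set (PacketAlgebra p k)) ⊆ normalizedPacket p k := by
      rintro _ ⟨x, hx, rfl⟩
      have hmem : algebraMap ℚ_[p] (PacketAlgebra p k) ((p : ℚ_[p]) ^ (n' - m')) ∈ normalizedPacket p k := by
        rw [← (iota p k a).commutes]
        refine integerPacket_le_normalizedPacket p k (iota_mem_integerPacket_of_norm_le_one p k a ?_)
        rw [norm_algebraMap', norm_zpow, Padic.norm_p, inv_zpow']
        exact zpow_le_one_of_nonpos₀ (by exact_mod_cast hp.out.one_lt.le) (by omega)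
      change ((p : ℚ_[p]) ^ (n' - m')) • x ∈ (normalizedPacket p k : Set (PacketAlgebra p k))
      rw [Algebra.smul_def]
      exact mul_mem hmem hx
    calc ((p : ℚ_[p]) ^ n') • (normalizedPacket p k : Set (PacketAlgebra p k))
        = ((p : ℚ_[p]) ^ m' * (p : ℚ_[p]) ^ (n' - m')) • (normalizedPacket p k : Set (PacketAlgebra p k)) := by
          rw [← zpow_add₀ hp0, add_sub_cancel]
      _ = ((p : ℚ_[p]) ^ m') • (((p : ℚ_[p]) ^ (n' - m')) • (normalizedPacket p k : Set (PacketAlgebra p k))) :=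
          (smul_smul _ _ _).symm
      _ ⊆ ((p : ℚ_[p]) ^ m') • (normalizedPacket p k : Set (PacketAlgebra p k)) := Set.smul_set_mono hsub
  apply le_antisymm
  · exact Set.iUnion_subset fun b => hnest (Finset.inf'_le n (Finset.mem_univ b))
  · obtain ⟨b₀, -, hb₀⟩ := Finset.exists_mem_eq_inf' Finset.univ_nonempty n
    rw [hb₀]
    exact Set.subset_iUnion (fun b => ((p : ℚ_[p]) ^ n b) • (normalizedPacket p k : Set (PacketAlgebra p k))) b₀

end Packet

/-! ## §2 The E-MIN law at a prime: unramified odd (any rank), and rank one (any prime) -/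

section MinLaw

variable {F : Type} [Field F] [NumberField F]
variable (p : ℕ) [hp : Fact p.Prime] (𝔽 : LocalFields F p)
variable (c : (j : ℕ) → (Fin (j + 1) → placesOver F p) → ℚ_[p]) (hc0 : ∀ j e, c j e ≠ 0)
  (hcσ : ∀ (j : ℕ) (σ : Equiv.Perm (Fin (j + 1))) (e : Fin (j + 1) → placesOver F p), c j (e ∘ σ) = c j e)

/-- **THE E-MIN LAW at an UNRAMIFIED ODD prime** (real packet, ANY shell scalar, ANY idele given by its norms `‖t_{i,v}‖ = p^{−n_i(v)}`):
`−|log(Θ)|_p = (1/ℓ⋇)·Σ_i Σ_{v⃗} (−(min_b n_i(v_b))·log p)·Π_b Pr(v_b)` — every slot region is the scalar ball `p^{n_i(v_b)}·(R_{v⃗})^∼`, the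
(Ind1) slot union is the largest ball `p^{min}·(R_{v⃗})^∼`, its (Ind2)-orbit and hull are itself ([IUTchIV] Prop. 1.2 (iv); XXVIId-b),
of log-volume `−min·log p`. [cite: Mochizuki2012, IUTchIV Prop. 1.2 (iv) p. 11, Thm. 1.10 Step (vi) p. 29]
[cite: DupuyHilado2025, Def. 3.6.3, §4.7, §4.11–4.12] [claim: Mochizuki2012, status: disputed] -/
theorem realPrimePacketWith_negLogThetaAt_eq_min_of_unramified (hp2 : 2 < p)
    (he : ∀ v : placesOver F p, absRamificationIdx p (𝔽.k v) = 1) {lstar : ℕ}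
    (t : Fin lstar → (v : placesOver F p) → (𝔽.k v)ˣ) (n : Fin lstar → placesOver F p → ℤ)
    (ht : ∀ (i : Fin lstar) (v : placesOver F p), ‖(t i v : 𝔽.k v)‖ = (p : ℝ) ^ (-(n i v))) :
    (realPrimePacketWith p 𝔽 c hc0 hcσ).negLogThetaAt lstar t =
      (1 / (lstar : ℝ)) * ∑ i : Fin lstar, ∑ e : Fin ((i : ℕ) + 1 + 1) → placesOver F p,
        -(((Finset.univ.inf' Finset.univ_nonempty fun b => n i (e b) : ℤ) : ℝ) * Real.log p) *
          ∏ b, weight F (e b).1 := by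
  classical
  have hval : ∀ (i : Fin lstar) (e : Fin ((i : ℕ) + 1 + 1) → placesOver F p),
      (realPrimePacketWith p 𝔽 c hc0 hcσ).logμ ((realPrimePacketWith p 𝔽 c hc0 hcσ).possibleImagesHull
        ((realPrimePacketWith p 𝔽 c hc0 hcσ).pilotRegion t) ((i : ℕ) + 1) e) =
        -(((Finset.univ.inf' Finset.univ_nonempty fun b => n i (e b) : ℤ) : ℝ) * Real.log p) := by
    intro i e
    have hI : 2 ≤ Fintype.card (Fin ((i : ℕ) + 1 + 1)) := by simp
    have hslots : (⋃ a : Fin ((i : ℕ) + 1 + 1), iota p (fun b => 𝔽.k (e b)) a (t i (e a) : 𝔽.k (e a)) •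
          (normalizedPacket p (fun b => 𝔽.k (e b)) : Set (PacketAlgebra p (fun b => 𝔽.k (e b))))) =
        ((p : ℚ_[p]) ^ Finset.univ.inf' Finset.univ_nonempty fun b => n i (e b)) •
          (normalizedPacket p (fun b => 𝔽.k (e b)) : Set (PacketAlgebra p (fun b => 𝔽.k (e b)))) := by
      rw [Set.iUnion_congr fun a => iota_smul_normalizedPacket_eq_zpow_smul_of_norm_eq p (fun b => 𝔽.k (e b)) a
        _ (n i (e a)) (ht i (e a)), iUnion_zpow_smul_normalizedPacket_eq]
    change packetLogμ p (fun b => 𝔽.k (e b)) (packetHull p (fun b => 𝔽.k (e b))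
      ((realPrimePacketWith p 𝔽 c hc0 hcσ).possibleImages
        ((realPrimePacketWith p 𝔽 c hc0 hcσ).pilotRegion t) ((i : ℕ) + 1) e)) = _
    rw [realPrimePacketWith_possibleImages_pilotRegion_eq p 𝔽 c hc0 hcσ t i e, hslots,
      iUnion_indTwo_smul_smul_normalizedPacket_eq p (fun b => 𝔽.k (e b)) hI hp2 (fun b => he (e b)) _,
      ← ppow_smul_set_eq, packetHull_smul_normalizedPacket,
      packetLogμ_ppow_smul p _ _ (packetAdm_normalizedPacket p _), packetLogμ_normalizedPacket, add_zero]
  unfold PrimePacket.negLogThetaAt PrimePacket.lnνLp PrimePacket.lnνTensorPower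
  refine congrArg (fun x : ℝ => (1 / (lstar : ℝ)) * x)
    (Finset.sum_congr rfl fun i _ => Finset.sum_congr rfl fun e _ => ?_)
  rw [hval i e]

/-- **The BARE value at a prime** (ANY rank, ANY prime): for an idele with `‖t_{i,v}‖ = p^{−n_i(v)}`,
`ln ν̄(O_𝕃(−div t)_p) = (1/ℓ⋇)·Σ_i Σ_{v⃗} (−n_i(v_last)·log p)·Π_b Pr(v_b)` — the region of the summand `v⃗` is the ball
`p^{n_i(v_last)}·(R_{v⃗})^∼` (peel action at the last index; Dupuy–Hilado §3.9 / Thm. 3.10.1).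
[cite: DupuyHilado2025, §3.9, Thm. 3.10.1] -/
theorem realPrimePacketWith_negAbsLogQAt_eq_of_norm {lstar : ℕ}
    (t : Fin lstar → (v : placesOver F p) → (𝔽.k v)ˣ) (n : Fin lstar → placesOver F p → ℤ)
    (ht : ∀ (i : Fin lstar) (v : placesOver F p), ‖(t i v : 𝔽.k v)‖ = (p : ℝ) ^ (-(n i v))) :
    (realPrimePacketWith p 𝔽 c hc0 hcσ).negAbsLogQAt lstar t =
      (1 / (lstar : ℝ)) * ∑ i : Fin lstar, ∑ e : Fin ((i : ℕ) + 1 + 1) → placesOver F p,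
        -((n i (e (Fin.last ((i : ℕ) + 1))) : ℝ) * Real.log p) * ∏ b, weight F (e b).1 := by
  classical
  have hval : ∀ (i : Fin lstar) (e : Fin ((i : ℕ) + 1 + 1) → placesOver F p),
      (realPrimePacketWith p 𝔽 c hc0 hcσ).logμ ((realPrimePacketWith p 𝔽 c hc0 hcσ).pilotRegion t ((i : ℕ) + 1) e) =
        -((n i (e (Fin.last ((i : ℕ) + 1))) : ℝ) * Real.log p) := by
    intro i e
    have hreg : (realPrimePacketWith p 𝔽 c hc0 hcσ).pilotRegion t ((i : ℕ) + 1) e =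
        iota p (fun b => 𝔽.k (e b)) (Fin.last ((i : ℕ) + 1)) (t i (e (Fin.last ((i : ℕ) + 1))) : 𝔽.k (e (Fin.last _))) •
          (normalizedPacket p (fun b => 𝔽.k (e b)) : Set (PacketAlgebra p (fun b => 𝔽.k (e b)))) := by
      unfold PrimePacket.pilotRegion
      rw [dif_pos ⟨Nat.succ_pos _, by simp [i.2]⟩, ← Set.image_smul]
      rfl
    change packetLogμ p (fun b => 𝔽.k (e b)) ((realPrimePacketWith p 𝔽 c hc0 hcσ).pilotRegion t ((i : ℕ) + 1) e) = _
    rw [hreg, iota_smul_normalizedPacket_eq_zpow_smul_of_norm_eq p (fun b => 𝔽.k (e b)) (Fin.last _) _ _ (ht i _),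
      ← ppow_smul_set_eq, packetLogμ_ppow_smul p _ _ (packetAdm_normalizedPacket p _), packetLogμ_normalizedPacket, add_zero]
  unfold PrimePacket.negAbsLogQAt PrimePacket.lnνLp PrimePacket.lnνTensorPower
  refine congrArg (fun x : ℝ => (1 / (lstar : ℝ)) * x)
    (Finset.sum_congr rfl fun i _ => Finset.sum_congr rfl fun e _ => ?_)
  rw [hval i e]

/-- **THE MIXING GAIN**: at an unramified odd prime the whole inflation `−|log(Θ)|_p − ln ν̄(O_𝕃(−P_Θ)_p)` of the typed number is
`(log p/ℓ⋇)·Σ_i Σ_{v⃗} (Π Pr)·(n_i(v_last) − min_b n_i(v_b))` — (Ind2) and the hull contribute nothing, (Ind1) contributes the gain of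
replacing the last-slot exponent by the minimum over the slots. [cite: Mochizuki2012, IUTchIV Thm. 1.10 Step (v)–(vi) p. 27–29]
[cite: DupuyHilado2025, §4.7, §4.11–4.12] [claim: Mochizuki2012, status: disputed] -/
theorem mixing_gain_eq (hp2 : 2 < p) (he : ∀ v : placesOver F p, absRamificationIdx p (𝔽.k v) = 1) {lstar : ℕ}
    (t : Fin lstar → (v : placesOver F p) → (𝔽.k v)ˣ) (n : Fin lstar → placesOver F p → ℤ)
    (ht : ∀ (i : Fin lstar) (v : placesOver F p), ‖(t i v : 𝔽.k v)‖ = (p : ℝ) ^ (-(n i v))) :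
    (realPrimePacketWith p 𝔽 c hc0 hcσ).negLogThetaAt lstar t - (realPrimePacketWith p 𝔽 c hc0 hcσ).negAbsLogQAt lstar t =
      (1 / (lstar : ℝ)) * ∑ i : Fin lstar, ∑ e : Fin ((i : ℕ) + 1 + 1) → placesOver F p,
        ((n i (e (Fin.last ((i : ℕ) + 1))) : ℝ) - ((Finset.univ.inf' Finset.univ_nonempty fun b => n i (e b) : ℤ) : ℝ)) *
          Real.log p * ∏ b, weight F (e b).1 := by
  rw [realPrimePacketWith_negLogThetaAt_eq_min_of_unramified p 𝔽 c hc0 hcσ hp2 he t n ht,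
    realPrimePacketWith_negAbsLogQAt_eq_of_norm p 𝔽 c hc0 hcσ t n ht, ← mul_sub, ← Finset.sum_sub_distrib]
  refine congrArg (fun x : ℝ => (1 / (lstar : ℝ)) * x) (Finset.sum_congr rfl fun i _ => ?_)
  rw [← Finset.sum_sub_distrib]
  exact Finset.sum_congr rfl fun e _ => by ring

/-- **The free inequality at the prime, EXACT form**: `ln ν̄(O_𝕃(−P_Θ)_p) ≤ −|log(Θ)|_p` at an unramified odd prime, with equality iff
the mixing gain vanishes (`min ≤ last slot`, weights `≥ 0`). [cite: DupuyHilado2025, §4.10–4.12] [claim: Mochizuki2012, status: disputed] -/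
theorem negAbsLogQAt_le_negLogThetaAt_of_unramified (hp2 : 2 < p)
    (he : ∀ v : placesOver F p, absRamificationIdx p (𝔽.k v) = 1) {lstar : ℕ}
    (t : Fin lstar → (v : placesOver F p) → (𝔽.k v)ˣ) (n : Fin lstar → placesOver F p → ℤ)
    (ht : ∀ (i : Fin lstar) (v : placesOver F p), ‖(t i v : 𝔽.k v)‖ = (p : ℝ) ^ (-(n i v))) :
    (realPrimePacketWith p 𝔽 c hc0 hcσ).negAbsLogQAt lstar t ≤ (realPrimePacketWith p 𝔽 c hc0 hcσ).negLogThetaAt lstar t := by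
  have h := mixing_gain_eq p 𝔽 c hc0 hcσ hp2 he t n ht
  have hlogp : 0 ≤ Real.log p := Real.log_nonneg (by exact_mod_cast hp.out.one_lt.le)
  have hnn : 0 ≤ (1 / (lstar : ℝ)) * ∑ i : Fin lstar, ∑ e : Fin ((i : ℕ) + 1 + 1) → placesOver F p,
      ((n i (e (Fin.last ((i : ℕ) + 1))) : ℝ) - ((Finset.univ.inf' Finset.univ_nonempty fun b => n i (e b) : ℤ) : ℝ)) *
        Real.log p * ∏ b, weight F (e b).1 := by
    refine mul_nonneg (by positivity) (Finset.sum_nonneg fun i _ => Finset.sum_nonneg fun e _ =>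
      mul_nonneg (mul_nonneg ?_ hlogp) (Finset.prod_nonneg fun b _ => weight_nonneg F (e b).1))
    have hle : (Finset.univ.inf' Finset.univ_nonempty fun b => n i (e b)) ≤ n i (e (Fin.last ((i : ℕ) + 1))) :=
      Finset.inf'_le _ (Finset.mem_univ _)
    have hle' : (((Finset.univ.inf' Finset.univ_nonempty fun b => n i (e b) : ℤ) : ℝ)) ≤ (n i (e (Fin.last ((i : ℕ) + 1))) : ℝ) := by
      exact_mod_cast hle
    linarith
  linarith

/-- **INFLATION VANISHES IFF THE EXPONENTS ARE SLOT-CONSTANT**: at an unramified odd prime, `−|log(Θ)|_p = ln ν̄(O_𝕃(−P_Θ)_p)` iff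
for every index `i` the exponent `n_i(v)` does not depend on the place `v | p` (⇐: the minimum over a constant tuple is the constant;
⇒: every tuple `(v, …, v, w)` has positive weight, so `n_i(w) = min(n_i(v), n_i(w))`). The (Ind1) mixing gain is the whole story at such
a prime. [cite: Mochizuki2012, IUTchIV Thm. 1.10 Step (v)–(vi) p. 27–29] [cite: DupuyHilado2025, §4.7] [claim: Mochizuki2012, status: disputed] -/
theorem negLogThetaAt_eq_negAbsLogQAt_iff_slotConstant (hp2 : 2 < p)
    (he : ∀ v : placesOver F p, absRamificationIdx p (𝔽.k v) = 1) {lstar : ℕ}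
    (t : Fin lstar → (v : placesOver F p) → (𝔽.k v)ˣ) (n : Fin lstar → placesOver F p → ℤ)
    (ht : ∀ (i : Fin lstar) (v : placesOver F p), ‖(t i v : 𝔽.k v)‖ = (p : ℝ) ^ (-(n i v))) :
    (realPrimePacketWith p 𝔽 c hc0 hcσ).negLogThetaAt lstar t = (realPrimePacketWith p 𝔽 c hc0 hcσ).negAbsLogQAt lstar t ↔
      ∀ (i : Fin lstar) (v w : placesOver F p), n i v = n i w := by
  classical
  have hgain := mixing_gain_eq p 𝔽 c hc0 hcσ hp2 he t n ht
  have hlogp : 0 < Real.log p := Real.log_pos (by exact_mod_cast hp.out.one_lt)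
  have hW : ∀ (m : ℕ) (e : Fin (m + 1) → placesOver F p), 0 < ∏ b, weight F (e b).1 := fun m e =>
    Finset.prod_pos fun b _ => div_pos (by exact_mod_cast localDegree_pos F (e b).1) FinDivisor.finrank_pos
  have hmin : ∀ (i : Fin lstar) (e : Fin ((i : ℕ) + 1 + 1) → placesOver F p),
      (((Finset.univ.inf' Finset.univ_nonempty fun b => n i (e b) : ℤ) : ℝ)) ≤ (n i (e (Fin.last ((i : ℕ) + 1))) : ℝ) :=
    fun i e => by exact_mod_cast Finset.inf'_le (fun b => n i (e b)) (Finset.mem_univ _)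
  have hterm : ∀ (i : Fin lstar) (e : Fin ((i : ℕ) + 1 + 1) → placesOver F p),
      0 ≤ ((n i (e (Fin.last ((i : ℕ) + 1))) : ℝ) - ((Finset.univ.inf' Finset.univ_nonempty fun b => n i (e b) : ℤ) : ℝ)) *
        Real.log p * ∏ b, weight F (e b).1 :=
    fun i e => mul_nonneg (mul_nonneg (by linarith [hmin i e]) hlogp.le) (hW _ e).le
  constructor
  · intro heq i v w
    have hl : (0 : ℝ) < lstar := by exact_mod_cast i.pos
    have hsum0 : ∑ i : Fin lstar, ∑ e : Fin ((i : ℕ) + 1 + 1) → placesOver F p,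
        ((n i (e (Fin.last ((i : ℕ) + 1))) : ℝ) - ((Finset.univ.inf' Finset.univ_nonempty fun b => n i (e b) : ℤ) : ℝ)) *
          Real.log p * ∏ b, weight F (e b).1 = 0 := by
      have h0 : (1 / (lstar : ℝ)) * _ = 0 := hgain.symm.trans (by rw [heq, sub_self])
      rcases mul_eq_zero.mp h0 with h | h
      · exact absurd h (by positivity)
      · exact h
    have hi := (Finset.sum_eq_zero_iff_of_nonneg fun i _ => Finset.sum_nonneg fun e _ => hterm i e).mp hsum0 i
      (Finset.mem_univ _)
    have key : ∀ v w : placesOver F p, n i w ≤ n i v := by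
      intro v w
      let e : Fin ((i : ℕ) + 1 + 1) → placesOver F p := fun b => if b = Fin.last ((i : ℕ) + 1) then w else v
      have he0 := (Finset.sum_eq_zero_iff_of_nonneg fun e _ => hterm i e).mp hi e (Finset.mem_univ _)
      have h1 : (n i (e (Fin.last ((i : ℕ) + 1))) : ℝ) -
          ((Finset.univ.inf' Finset.univ_nonempty fun b => n i (e b) : ℤ) : ℝ) = 0 := by
        rcases mul_eq_zero.mp he0 with h | h
        · rcases mul_eq_zero.mp h with h' | h'
          · exact h'
          · exact absurd h' hlogp.ne'
        · exact absurd h (hW _ e).ne'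
      have h2 : n i (e (Fin.last ((i : ℕ) + 1))) = Finset.univ.inf' Finset.univ_nonempty fun b => n i (e b) := by
        exact_mod_cast sub_eq_zero.mp h1
      have h3 : (Finset.univ.inf' Finset.univ_nonempty fun b => n i (e b)) ≤ n i (e 0) :=
        Finset.inf'_le _ (Finset.mem_univ _)
      have hel : e (Fin.last ((i : ℕ) + 1)) = w := if_pos rfl
      have hne : (0 : Fin ((i : ℕ) + 1 + 1)) ≠ Fin.last ((i : ℕ) + 1) := by
        intro h
        have h' := congrArg Fin.val h
        simp at h'
      have he0' : e 0 = v := if_neg hne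
      rw [hel] at h2
      rw [he0'] at h3
      omega
    exact le_antisymm (key w v) (key v w)
  · intro hconst
    rw [← sub_eq_zero, hgain]
    refine mul_eq_zero.mpr (Or.inr (Finset.sum_eq_zero fun i _ => Finset.sum_eq_zero fun e _ => ?_))
    have hge : n i (e (Fin.last ((i : ℕ) + 1))) ≤ Finset.univ.inf' Finset.univ_nonempty fun b => n i (e b) :=
      Finset.le_inf' _ _ fun b _ => (hconst i _ _).le
    have h0 : (n i (e (Fin.last ((i : ℕ) + 1))) : ℝ) -
        ((Finset.univ.inf' Finset.univ_nonempty fun b => n i (e b) : ℤ) : ℝ) = 0 := by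
      have hge' : (n i (e (Fin.last ((i : ℕ) + 1))) : ℝ) ≤
          ((Finset.univ.inf' Finset.univ_nonempty fun b => n i (e b) : ℤ) : ℝ) := by exact_mod_cast hge
      linarith [hmin i e]
    rw [h0, zero_mul, zero_mul]

end MinLaw

/-! ## §3 Input level: the E-MIN law for `negLogThetaLoc I p`, and [IUTchIV] Step (vi) at the input -/

section Input

variable {F₀ : Type} [Field F₀] [NumberField F₀] {K : Type} [Field K] [NumberField K] [Algebra F₀ K]
variable (I : ThetaVolumeInput F₀ K) (p : ℕ) [hp : Fact p.Prime]

/-- **Integral exponents at an absolutely unramified completion**: every `x ≠ 0` of a `ℚ_p`-field with `e = 1` has `‖x‖ = p^{−n}`, `n ∈ ℤ`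
(value group `p^ℤ`). [cite: NeukirchANT1999, Ch. II Prop. (5.3)] -/
theorem exists_int_norm_eq_of_unramified {L : Type*} [NontriviallyNormedField L] [NormedAlgebra ℚ_[p] L] [IsUltrametricDist L]
    [ProperSpace L] (he : absRamificationIdx p L = 1) {x : L} (hx : x ≠ 0) : ∃ n : ℤ, ‖x‖ = (p : ℝ) ^ (-n) := by
  obtain ⟨m, hm⟩ := exists_norm_eq_rpow p L hx
  refine ⟨m, ?_⟩
  rw [hm, he, Nat.cast_one, div_one, ← Int.cast_neg, Real.rpow_intCast]

/-- **The exponents of the Θ-idele at an unramified prime**: integers `n_i(v)` with `‖t_{Θ,i,v}‖ = p^{−n_i(v)}` and `e_v·n_i(v) = P_{Θ,i}(v)`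
(`ord_v = −e_v·log‖·‖/log p`). [cite: DupuyHilado2025, §2.4.2, §3.4, §3.9] -/
theorem exists_int_norms_tΘ_of_unramified
    (he : ∀ v : placesOver F₀ p, absRamificationIdx p ((I.σ.localFieldFamily p hp.out).k v) = 1) :
    ∃ n : Fin I.lstar → placesOver F₀ p → ℤ, ∀ (i : Fin I.lstar) (v : placesOver F₀ p),
      ‖(I.tΘ p hp.out i v : (I.σ.localFieldFamily p hp.out).k v)‖ = (p : ℝ) ^ (-(n i v)) ∧
        (ramIdx F₀ v.1 : ℝ) * n i v = I.X.thetaPilot i v.1 := by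
  have hlogp : Real.log p ≠ 0 :=
    Real.log_ne_zero_of_pos_of_ne_one (by exact_mod_cast hp.out.pos) (by exact_mod_cast hp.out.one_lt.ne')
  have key : ∀ (i : Fin I.lstar) (v : placesOver F₀ p), ∃ n : ℤ,
      ‖(I.tΘ p hp.out i v : (I.σ.localFieldFamily p hp.out).k v)‖ = (p : ℝ) ^ (-n) ∧
        (ramIdx F₀ v.1 : ℝ) * n = I.X.thetaPilot i v.1 := by
    intro i v
    obtain ⟨n, hn⟩ := exists_int_norm_eq_of_unramified p (he v) (I.tΘ p hp.out i v).ne_zero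
    refine ⟨n, hn, ?_⟩
    have hord := I.tΘ_ord p hp.out i v
    rw [LocalFields.ordv, hn, Real.log_zpow] at hord
    rw [← hord]
    field_simp
    push_cast
    ring
  choose n hn using key
  exact ⟨n, hn⟩

/-- **THE E-MIN LAW AT THE INPUT**: for every input `I`, every ODD prime `p` at which all `σ`-completions `K_{v̲}` (`v | p`) are
absolutely unramified, and exponents `n_i(v)` with `‖t_{Θ,i,v}‖ = p^{−n_i(v)}` (they exist, with `e_v·n_i(v) = P_{Θ,i}(v)`):
`negLogThetaLoc I p = (1/ℓ⋇)·Σ_i Σ_{v⃗ ∈ 𝕍_p^{i+2}} (−(min_b n_i(v_b))·log p)·Π_b Pr(v_b)`. HYPOTHESIS-free evaluation of OUR typed number;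
no side taken. [cite: Mochizuki2012, IUTchIV Prop. 1.2 (iv) p. 11, Thm. 1.10 Step (vi) p. 29] [cite: DupuyHilado2025, Def. 3.6.3, §4.7,
§4.11–4.12] [claim: Mochizuki2012, status: disputed] -/
theorem negLogThetaLoc_eq_min_of_unramified (hp2 : 2 < p)
    (he : ∀ v : placesOver F₀ p, absRamificationIdx p ((I.σ.localFieldFamily p hp.out).k v) = 1)
    (n : Fin I.lstar → placesOver F₀ p → ℤ)
    (hn : ∀ (i : Fin I.lstar) (v : placesOver F₀ p),
      ‖(I.tΘ p hp.out i v : (I.σ.localFieldFamily p hp.out).k v)‖ = (p : ℝ) ^ (-(n i v))) :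
    I.negLogThetaLoc p =
      (1 / (I.lstar : ℝ)) * ∑ i : Fin I.lstar, ∑ e : Fin ((i : ℕ) + 1 + 1) → placesOver F₀ p,
        -(((Finset.univ.inf' Finset.univ_nonempty fun b => n i (e b) : ℤ) : ℝ) * Real.log p) *
          ∏ b, weight F₀ (e b).1 := by
  rw [I.negLogThetaLoc_of_prime hp.out]
  exact realPrimePacketWith_negLogThetaAt_eq_min_of_unramified p (I.σ.localFieldFamily p hp.out)
    (mScale p (I.σ.localFieldFamily p hp.out)) (mScale_ne_zero p (I.σ.localFieldFamily p hp.out))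
    (mScale_perm p (I.σ.localFieldFamily p hp.out)) hp2 he (I.tΘ p hp.out) n hn

/-- **[IUTchIV] Thm. 1.10 Step (vi) AT THE INPUT**: for every input `I` and every ODD prime `p` carrying NO bad place, at which all
`σ`-completions are absolutely unramified, `negLogThetaLoc I p = 0` — the Θ-idele is a unit at every `v | p`, every slot region is `(R_{v⃗})^∼`,
and (Ind1), (Ind2), the hull add nothing ("the “container of possible images” is precisely equal to" the integral structure).
[cite: Mochizuki2012, IUTchIV Thm. 1.10 Step (vi) p. 29] [claim: Mochizuki2012, status: disputed] -/
theorem negLogThetaLoc_eq_zero_of_unramified_of_forall_not_mem (hp2 : 2 < p)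
    (he : ∀ v : placesOver F₀ p, absRamificationIdx p ((I.σ.localFieldFamily p hp.out).k v) = 1)
    (hS : ∀ v : placesOver F₀ p, v.1 ∉ I.X.S) : I.negLogThetaLoc p = 0 := by
  have hlogp : Real.log p ≠ 0 :=
    Real.log_ne_zero_of_pos_of_ne_one (by exact_mod_cast hp.out.pos) (by exact_mod_cast hp.out.one_lt.ne')
  have hunit : ∀ (i : Fin I.lstar) (v : placesOver F₀ p),
      ‖(I.tΘ p hp.out i v : (I.σ.localFieldFamily p hp.out).k v)‖ = (p : ℝ) ^ (-((fun _ _ => (0 : ℤ)) i v)) := by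
    intro i v
    have hord := I.tΘ_ord p hp.out i v
    rw [PilotData.thetaPilot_apply_of_not_mem I.X i (hS v), LocalFields.ordv] at hord
    have he0 : (ramIdx F₀ v.1 : ℝ) ≠ 0 := by exact_mod_cast ramIdx_ne_zero F₀ v.1
    have h1 : -(ramIdx F₀ v.1 : ℝ) * Real.log ‖(I.tΘ p hp.out i v : (I.σ.localFieldFamily p hp.out).k v)‖ = 0 := by
      rcases div_eq_zero_iff.mp hord with h | h
      · exact h
      · exact absurd h hlogp
    have hlog : Real.log ‖(I.tΘ p hp.out i v : (I.σ.localFieldFamily p hp.out).k v)‖ = 0 := by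
      rcases mul_eq_zero.mp h1 with h | h
      · exact absurd (neg_eq_zero.mp h) he0
      · exact h
    have hpos : 0 < ‖(I.tΘ p hp.out i v : (I.σ.localFieldFamily p hp.out).k v)‖ :=
      norm_pos_iff.mpr (I.tΘ p hp.out i v).ne_zero
    rw [neg_zero, zpow_zero]
    rcases Real.log_eq_zero.mp hlog with h | h | h
    · exact absurd h hpos.ne'
    · exact h
    · linarith
  rw [negLogThetaLoc_eq_min_of_unramified I p hp2 he (fun _ _ => 0) hunit]
  simp

end Input

end Summit.ABC.IUTFork.GenuineContent

end
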